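import Literature.AlgebraicGeometry.Modules.SheafHomLeftExact
import Literature.AlgebraicGeometry.Modules.SheafHomUnit
import Literature.AlgebraicGeometry.Modules.LineBundleOfCocycleClass
import Literature.Algebra.Homology.ExtClassNineDiagram
import HarnessLib

/-!
# Contraction with an extension class `κ ∈ Ext¹(𝒪_X, T)`: the classes `c_κ(F) ∈ Ext¹(𝓗om(T, F), F)`,
# their naturality in `F`, and their square with connecting classes

Let `X` be a scheme, `T` an `𝒪_X`-module and `κ : 0 → T →ι 𝒦 →π 𝒪_X → 0` a short exact sequence of
`𝒪_X`-modules — an extension of the structure sheaf by `T`, i.e. a representative of a class in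
`Ext¹(𝒪_X, T)` (`= H¹(X, T)`; every such class has a representative, Mathlib ∕ the tree's
`Ext.exists_shortExact_extClass_eq`). Since `𝒪_X` is finite locally free
(`isFiniteLocallyFree_unitModule`), `κ` is locally split and the contravariant internal Hom
`𝓗om(–, F)` takes it, for EVERY `𝒪_X`-module `F`, to a short exact sequence
(`Modules/SheafHomLeftExact.lean`, `shortExact_sheafHomLeft`)

  `𝓗om(κ, F) : 0 → 𝓗om(𝒪_X, F) → 𝓗om(𝒦, F) → 𝓗om(T, F) → 0`   (`shortExact_sheafHomLeft_extension`),

functorial in `F`. Transporting its class along `𝓗om(𝒪_X, F) ≅ F` (`Modules/SheafHomUnit.lean`,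
`unitSheafHomIso` = evaluation at `1`) gives

* `contractionClass hκ F : Ext¹(𝓗om(T, F), F)` — **the contraction with `κ`**;
* `contractionClass_comp_mk₀` — **naturality in `F`**: for `f : F → G`,
  `c_κ(F) ∘ f = 𝓗om(T, f) ∘ c_κ(G)` (diagrammatic `Ext.comp`; from Mathlib's `extClass_naturality`
  along `𝓗om(κ, f)` and the naturality of evaluation at `1`);
* `twistExtClass_comp_contractionClass_add_eq_zero ∕ _eq_neg ∕ _eq_units_smul` — **the square with
  the connecting classes**: for a short exact `S : 0 → E₊ → E₋ → E → 0` whose twist `𝓗om(T, S)` is short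
  exact (automatic for `T` finite locally free, `…_of_isFiniteLocallyFree`),
  `[𝓗om(T, S)] ∘ c_κ(E₊) = −c_κ(E) ∘ [S]` in `Ext²(𝓗om(T, E), E₊)`. PROOF: the three sequences
  `𝓗om(κ, E₊), 𝓗om(κ, E₋), 𝓗om(κ, E)` with the maps induced by `S` form a commutative `3 × 3`
  diagram with short exact rows whose outer columns are `𝓗om(𝒪_X, S) ≅ S` and `𝓗om(T, S)`; the two
  composite connecting classes of such a diagram anticommute (Cartan–Eilenberg III.4.1 in
  `Ext`-class form, `Literature.Algebra.Homology.NineDiagram`), and `[𝓗om(𝒪_X, S)]` is carried to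
  `[S]` by the natural isomorphism `𝓗om(𝒪_X, –) ≅ 𝟭` (`extClass_naturality` again).

For `T = 𝒯_X = (Ω¹_{X∕k})^∨` and `κ` the class of a first-order deformation of `X`, composing the
Atiyah class `At(F) ∈ Ext¹(F, 𝓗om(𝒯, F))` with `c_κ(F)` is how the obstruction `ob_κ(F) ∈ Ext²(F, F)`
to deforming `F` along `κ` is formed (Illusie; Huybrechts–Thomas, «the product of the Atiyah class
and the Kodaira–Spencer class»; Buchweitz–Flenner §4) — that use, and the comparison of `c_κ` with
the cup product `κ ∪ –` through `𝓗om(T, F) ≅ T^∨ ⊗ F` for `T` locally free, are NOT in this file,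
which is generic in the scheme and in `T`. Written for the venture `HSemireg` (cell `pub-hsemireg`,
seat s4-prove-1 g29, 2026-08-28; construction (c3)–(c4) priced on the cell bus, director-hodge
R13.58): it discharges the hypotheses `Contraction.comm` and `hcδ` of
`Summit.Ventures.HSemireg.TwoLevelObstruction` (NOT here). Everything is proved; no named fact
(`def … : Prop`), no instance, no notation.

## References

* R. Hartshorne, *Algebraic Geometry*, GTM 52 (1977): II Ex. 5.1 (p. 123), III.6 (pp. 233–235:
  `𝓗om`, `Ext`, exactness for locally free sheaves). [Hartshorne1977]
* The Stacks project, Tag 01CM (Modules: internal Hom). [StacksProject]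
* H. Cartan, S. Eilenberg, *Homological Algebra* (1956), Ch. III §4 Prop. 4.1 (anticommutativity
  of the two composite connecting homomorphisms of a `3 × 3` diagram). [CartanEilenberg1956]
* D. Huybrechts, R. P. Thomas, *Deformation-obstruction theory for complexes via Atiyah and
  Kodaira–Spencer classes*, Math. Ann. 346 (2010), §1 (obstruction = Atiyah class · Kodaira–Spencer
  class). [HuybrechtsThomas2010]
* R.-O. Buchweitz, H. Flenner, *A semiregularity map for modules and applications to
  deformations*, Compositio Math. 137 (2003), §4. [BuchweitzFlenner2003]
-/

noncomputable section

open CategoryTheory CategoryTheory.Abelian AlgebraicGeometry Opposite TopologicalSpace Limits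

namespace Literature.AlgebraicGeometry.Modules

open Literature.AlgebraicGeometry.Motives Literature.Algebra.Homology

universe w u

variable {X : Scheme.{u}}

/-! ### `𝒪_X` is finite locally free; `𝓗om(𝒪_X, –)` and `𝓗om(T, –)` on short exact sequences -/

/-- **The structure sheaf is finite locally free** (frame `𝒪^{PUnit} ≅ 𝒪_X|_X`, the tree's
`freePUnitIso`). The same statement is proved inside two summit trees
(`Summit.ResolutionOfSingularities.…isFiniteLocallyFree_unitModule`,
`…FormalVectorBundlesAlgebraize…isFiniteLocallyFree_unit`), not importable from `Literature`; this is its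
library home. [cite: StacksProject, Tag 01C6 (Modules, Def. 17.14.1)] -/
theorem isFiniteLocallyFree_unitModule : IsFiniteLocallyFree (unitModule X) :=
  fun _ => ⟨⊤, trivial, PUnit, inferInstance, ⟨freePUnitIso ⊤⟩⟩

variable {S : ShortComplex X.Modules}

/-- `𝓗om(T, –)` carries short exact sequences to short exact sequences when `T` is finite locally
free (exactness of `𝓗om(T, –)`, `Modules/SheafHomExact.lean`).
[cite: Hartshorne1977, III.6 (proof of Prop. 6.5) and II Ex. 5.1 (b)] -/
theorem shortExact_map_sheafHomFunctor_of_isFiniteLocallyFree (hS : S.ShortExact) {T : X.Modules}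
    (hT : IsFiniteLocallyFree T) : (S.map (sheafHomFunctor T)).ShortExact :=
  have := preservesFiniteColimits_sheafHomFunctor T hT
  hS.map_of_exact _

/-- `𝓗om(𝒪_X, –)` carries short exact sequences to short exact sequences.
[cite: Hartshorne1977, III.6 (proof of Prop. 6.5) and II Ex. 5.1 (b)] -/
theorem shortExact_map_sheafHomFunctor_unitModule (hS : S.ShortExact) :
    (S.map (sheafHomFunctor (unitModule X))).ShortExact :=
  shortExact_map_sheafHomFunctor_of_isFiniteLocallyFree hS isFiniteLocallyFree_unitModule

variable (S) in
/-- The natural isomorphism `𝓗om(𝒪_X, –) ≅ 𝟭` (evaluation at `1`) on a short complex: the morphism of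
short complexes `𝓗om(𝒪_X, S) ⟶ S`. [cite: StacksProject, Tag 01CM] -/
def unitEvalShortComplexMap : S.map (sheafHomFunctor (unitModule X)) ⟶ S :=
  ShortComplex.homMk (unitEval S.X₁) (unitEval S.X₂) (unitEval S.X₃)
    (unitEval_naturality S.f) (unitEval_naturality S.g)

/-! ### Typed connecting classes of the twisted sequences `𝓗om(T, S)` and `𝓗om(𝒪_X, S)` -/

section Twist

variable [HasExt.{w} X.Modules] {T : X.Modules}

/-- The class `[𝓗om(T, S)] ∈ Ext¹(𝓗om(T, E), 𝓗om(T, E₊))` of the twisted sequence, TYPED on the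
objects `sheafHom T _` (definitionally Mathlib's `hTS.extClass`, whose type is spelled with
`(S.map _).X₃ ∕ .X₁`; this spelling composes with classes on `𝓗om(T, E)` without annotations).
[folklore] -/
abbrev twistExtClass (hTS : (S.map (sheafHomFunctor T)).ShortExact) :
    Ext.{w} (sheafHom T S.X₃) (sheafHom T S.X₁) 1 :=
  hTS.extClass

/-- The class `[𝓗om(𝒪_X, S)] ∈ Ext¹(𝓗om(𝒪_X, E), 𝓗om(𝒪_X, E₊))`, typed on the objects
`sheafHom (unitModule X) _`. [folklore] -/
abbrev unitTwistExtClass (hS : S.ShortExact) :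
    Ext.{w} (sheafHom (unitModule X) S.X₃) (sheafHom (unitModule X) S.X₁) 1 :=
  (shortExact_map_sheafHomFunctor_unitModule hS).extClass

/-- `[𝓗om(𝒪_X, S)] ∘ ev₁ = ev₁ ∘ [S]`: the class of `𝓗om(𝒪_X, S)` is carried to the class of `S` by
the natural isomorphism `𝓗om(𝒪_X, –) ≅ 𝟭` (naturality of `extClass` along
`unitEvalShortComplexMap S`). [cite: StacksProject, Tag 01CM] -/
theorem unitTwistExtClass_comp_mk₀_unitEval (hS : S.ShortExact) :
    (unitTwistExtClass hS).comp (Ext.mk₀ (unitEval S.X₁)) (add_zero 1) =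
      (Ext.mk₀ (unitEval S.X₃)).comp hS.extClass (zero_add 1) :=
  (shortExact_map_sheafHomFunctor_unitModule hS).extClass_naturality hS (unitEvalShortComplexMap S)

end Twist

/-! ### The short exact sequences `𝓗om(κ, F)` of an extension `κ` of `𝒪_X` by `T` -/

section Extension

variable {T K : X.Modules} {ι : T ⟶ K} {π : K ⟶ unitModule X} {w : ι ≫ π = 0}

/-- **`𝓗om(κ, F) : 0 → 𝓗om(𝒪_X, F) → 𝓗om(𝒦, F) → 𝓗om(T, F) → 0` is short exact** for every
extension `κ : 0 → T → 𝒦 → 𝒪_X → 0` and every `F` (`κ` is locally split, `𝒪_X` being finite locally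
free). [cite: Hartshorne1977, III.6 (proof of Prop. 6.7) and II Ex. 5.1 (b)] -/
theorem shortExact_sheafHomLeft_extension (hκ : (ShortComplex.mk ι π w).ShortExact)
    (F : X.Modules) : (sheafHomLeftShortComplex (ShortComplex.mk ι π w) F).ShortExact :=
  shortExact_sheafHomLeft F hκ isFiniteLocallyFree_unitModule

/-- The morphisms `𝓗om(κ, f) ≫ 𝓗om(κ, g)` induced by two composable maps with `f ≫ g = 0` compose to
zero (functoriality of `𝓗om(κ, –)`). [cite: StacksProject, Tag 01CM] -/
theorem sheafHomLeftShortComplexMap_f_comp_g {κ : ShortComplex X.Modules} :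
    sheafHomLeftShortComplexMap (S := κ) S.f ≫ sheafHomLeftShortComplexMap S.g = 0 := by
  rw [← sheafHomLeftShortComplexMap_comp, S.zero, sheafHomLeftShortComplexMap_zero]

variable [HasExt.{w} X.Modules]

/-- The class `[𝓗om(κ, F)] ∈ Ext¹(𝓗om(T, F), 𝓗om(𝒪_X, F))` of the extension `𝓗om(κ, F)`, TYPED on the
objects `sheafHom _ F` (definitionally the `extClass` of `shortExact_sheafHomLeft_extension hκ F`).
[cite: Hartshorne1977, III Ex. 6.1 (p. 237: extensions of `F″` by `F′` are classified by `Ext¹(F″, F′)`) with III.6 proof of Prop. 6.7] -/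
def homExtClass (hκ : (ShortComplex.mk ι π w).ShortExact) (F : X.Modules) :
    Ext.{w} (sheafHom T F) (sheafHom (unitModule X) F) 1 :=
  (shortExact_sheafHomLeft_extension hκ F).extClass

/-- **Naturality of `[𝓗om(κ, F)]` in `F`**: for `f : F → G`,
`[𝓗om(κ, F)] ∘ 𝓗om(𝒪_X, f) = 𝓗om(T, f) ∘ [𝓗om(κ, G)]` — Mathlib's `extClass_naturality` along the
morphism of short exact sequences `𝓗om(κ, f) : 𝓗om(κ, F) → 𝓗om(κ, G)`.
[cite: Hartshorne1977, III.6 (functoriality of `𝓗om` and `Ext`)] -/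
theorem homExtClass_naturality (hκ : (ShortComplex.mk ι π w).ShortExact) {F G : X.Modules}
    (f : F ⟶ G) :
    (homExtClass hκ F).comp (Ext.mk₀ (sheafHomMap (unitModule X) f)) (add_zero 1) =
      (Ext.mk₀ (sheafHomMap T f)).comp (homExtClass hκ G) (zero_add 1) :=
  (shortExact_sheafHomLeft_extension hκ F).extClass_naturality
    (shortExact_sheafHomLeft_extension hκ G) (sheafHomLeftShortComplexMap f)

/-- **The contraction with the extension `κ`**: the `Ext¹`-class of the extension
`0 → F → 𝓗om(𝒦, F) → 𝓗om(T, F) → 0` (`𝓗om(κ, F)` with `𝓗om(𝒪_X, F) ≅ F` by evaluation at `1`), an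
element `c_κ(F) ∈ Ext¹(𝓗om(T, F), F)`.
[cite: Hartshorne1977, III Ex. 6.1 (p. 237: extensions of `F″` by `F′` are classified by `Ext¹(F″, F′)`) with III.6 proof of Prop. 6.7] -/
def contractionClass (hκ : (ShortComplex.mk ι π w).ShortExact) (F : X.Modules) :
    Ext.{w} (sheafHom T F) F 1 :=
  (homExtClass hκ F).comp (Ext.mk₀ (unitEval F)) (add_zero 1)

/-- Unfolding lemma: `c_κ(F) = [𝓗om(κ, F)] ∘ ev₁`. [folklore] -/
private theorem contractionClass_def (hκ : (ShortComplex.mk ι π w).ShortExact) (F : X.Modules) :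
    contractionClass hκ F = (homExtClass hκ F).comp (Ext.mk₀ (unitEval F)) (add_zero 1) := rfl

/-- **Naturality of the contraction in `F`**: for `f : F → G`,
`c_κ(F) ∘ f = 𝓗om(T, f) ∘ c_κ(G)` in `Ext¹(𝓗om(T, F), G)` (diagrammatic composition) — naturality of
`[𝓗om(κ, F)]` and of evaluation at `1`. [cite: Hartshorne1977, III.6 (functoriality of `𝓗om` and `Ext`)] -/
theorem contractionClass_comp_mk₀ (hκ : (ShortComplex.mk ι π w).ShortExact) {F G : X.Modules}
    (f : F ⟶ G) :
    (contractionClass hκ F).comp (Ext.mk₀ f) (add_zero 1) =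
      (Ext.mk₀ (sheafHomMap T f)).comp (contractionClass hκ G) (zero_add 1) := by
  rw [contractionClass_def, contractionClass_def, Ext.comp_assoc_of_third_deg_zero,
    Ext.mk₀_comp_mk₀, ← unitEval_naturality f, ← Ext.mk₀_comp_mk₀,
    ← Ext.comp_assoc_of_third_deg_zero (homExtClass hκ F), homExtClass_naturality hκ f]
  exact Ext.comp_assoc_of_third_deg_zero _ _ _ _

/-! ### The square with the connecting classes -/

/-- The `3 × 3` relation before transport: `[𝓗om(T, S)] ∘ [𝓗om(κ, E₊)] + [𝓗om(κ, E)] ∘ [𝓗om(𝒪_X, S)] = 0`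
in `Ext²(𝓗om(T, E), 𝓗om(𝒪_X, E₊))` — Cartan–Eilenberg III.4.1 (`Literature.Algebra.Homology.NineDiagram`)
for the diagram with rows `𝓗om(κ, E₊), 𝓗om(κ, E₋), 𝓗om(κ, E)` and columns induced by `S` (outer
columns `𝓗om(𝒪_X, S)` and `𝓗om(T, S)`). [cite: CartanEilenberg1956, Ch. III §4 Prop. 4.1 pp. 44–45] -/
theorem twistExtClass_comp_homExtClass_add_eq_zero (hκ : (ShortComplex.mk ι π w).ShortExact)
    (hS : S.ShortExact) (hTS : (S.map (sheafHomFunctor T)).ShortExact) {n : ℕ} (h : 1 + 1 = n) :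
    (twistExtClass hTS).comp (homExtClass hκ S.X₁) h +
      (homExtClass hκ S.X₃).comp (unitTwistExtClass hS) h = 0 :=
  NineDiagram.extClass_comp_extClass_add_eq_zero
    (sheafHomLeftShortComplexMap (S := ShortComplex.mk ι π w) S.f)
    (sheafHomLeftShortComplexMap S.g) sheafHomLeftShortComplexMap_f_comp_g
    (shortExact_sheafHomLeft_extension hκ S.X₁) (shortExact_sheafHomLeft_extension hκ S.X₂)
    (shortExact_sheafHomLeft_extension hκ S.X₃) (shortExact_map_sheafHomFunctor_unitModule hS)
    hTS h

/-- **The contraction anticommutes with connecting classes** (sum form): for a short exact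
`S : 0 → E₊ → E₋ → E → 0` whose twist `𝓗om(T, S)` is short exact,
`[𝓗om(T, S)] ∘ c_κ(E₊) + c_κ(E) ∘ [S] = 0` in `Ext²(𝓗om(T, E), E₊)` (stated in every degree `n` with
a proof of `1 + 1 = n`): the `3 × 3` relation transported along `𝓗om(𝒪_X, –) ≅ 𝟭`.
[cite: CartanEilenberg1956, Ch. III §4 Prop. 4.1 pp. 44–45] -/
theorem twistExtClass_comp_contractionClass_add_eq_zero (hκ : (ShortComplex.mk ι π w).ShortExact)
    (hS : S.ShortExact) (hTS : (S.map (sheafHomFunctor T)).ShortExact) {n : ℕ} (h : 1 + 1 = n) :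
    (twistExtClass hTS).comp (contractionClass hκ S.X₁) h +
      (contractionClass hκ S.X₃).comp hS.extClass h = 0 := by
  have e₁ : (twistExtClass hTS).comp (contractionClass hκ S.X₁) h =
      ((twistExtClass hTS).comp (homExtClass hκ S.X₁) h).comp (Ext.mk₀ (unitEval S.X₁))
        (add_zero n) :=
    (Ext.comp_assoc_of_third_deg_zero _ _ _ h).symm
  have e₃ : (contractionClass hκ S.X₃).comp hS.extClass h =
      ((homExtClass hκ S.X₃).comp (unitTwistExtClass hS) h).comp (Ext.mk₀ (unitEval S.X₁))
        (add_zero n) := by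
    rw [Ext.comp_assoc_of_third_deg_zero, unitTwistExtClass_comp_mk₀_unitEval hS]
    exact Ext.comp_assoc_of_second_deg_zero _ _ _ h
  rw [e₁, e₃, ← Ext.add_comp, twistExtClass_comp_homExtClass_add_eq_zero hκ hS hTS h,
    Ext.zero_comp]

/-- **`[𝓗om(T, S)] ∘ c_κ(E₊) = −c_κ(E) ∘ [S]`** in `Ext²(𝓗om(T, E), E₊)`.
[cite: CartanEilenberg1956, Ch. III §4 Prop. 4.1 pp. 44–45] -/
theorem twistExtClass_comp_contractionClass_eq_neg (hκ : (ShortComplex.mk ι π w).ShortExact)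
    (hS : S.ShortExact) (hTS : (S.map (sheafHomFunctor T)).ShortExact) {n : ℕ} (h : 1 + 1 = n) :
    (twistExtClass hTS).comp (contractionClass hκ S.X₁) h =
      -(contractionClass hκ S.X₃).comp hS.extClass h :=
  eq_neg_of_add_eq_zero_left (twistExtClass_comp_contractionClass_add_eq_zero hκ hS hTS h)

/-- The same with the sign as the unit `−1 ∈ ℤˣ` (the shape `hcδ`, `εc = −1`, of
`Summit.Ventures.HSemireg.TwoLevelObstruction.NaturalAlong.ofContraction`).
[cite: CartanEilenberg1956, Ch. III §4 Prop. 4.1 pp. 44–45] -/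
theorem twistExtClass_comp_contractionClass_eq_units_smul
    (hκ : (ShortComplex.mk ι π w).ShortExact) (hS : S.ShortExact)
    (hTS : (S.map (sheafHomFunctor T)).ShortExact) {n : ℕ} (h : 1 + 1 = n) :
    (twistExtClass hTS).comp (contractionClass hκ S.X₁) h =
      ((-1 : ℤˣ) : ℤ) • (contractionClass hκ S.X₃).comp hS.extClass h := by
  rw [Units.val_neg, Units.val_one, neg_one_zsmul]
  exact twistExtClass_comp_contractionClass_eq_neg hκ hS hTS h

/-- **`[𝓗om(T, S)] ∘ c_κ(E₊) = −c_κ(E) ∘ [S]` for `T` finite locally free** (the twist `𝓗om(T, S)`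
is then short exact): unconditional form. [cite: CartanEilenberg1956, Ch. III §4 Prop. 4.1 pp. 44–45] -/
theorem twistExtClass_comp_contractionClass_eq_neg_of_isFiniteLocallyFree
    (hκ : (ShortComplex.mk ι π w).ShortExact) (hS : S.ShortExact) (hT : IsFiniteLocallyFree T)
    {n : ℕ} (h : 1 + 1 = n) :
    (twistExtClass (shortExact_map_sheafHomFunctor_of_isFiniteLocallyFree hS hT)).comp
        (contractionClass hκ S.X₁) h =
      -(contractionClass hκ S.X₃).comp hS.extClass h :=
  twistExtClass_comp_contractionClass_eq_neg hκ hS _ h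

end Extension

end Literature.AlgebraicGeometry.Modules

end
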